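import Literature.Probability.RandomPlanarGeometry.USTPeanoPath
import HarnessLib

/-!
# The smallest UST Peano domain: a worked example (non-vacuity of `USTPeano.Domain`)

The class `𝔇*` of [LSW04] §4.1 (`Literature.Probability.RandomPlanarGeometry.USTPeano.Domain`)
and the type of Peano paths (`USTPeano.PeanoPath`) are inhabited: take `α` = the primal edge from
`(0, 0)` to `(1, 0)`, `β` = the single dual vertex `(1/2, 1/2)`, `a = (1/4, 1/4)` (Peano index
`(0, 0)`), `b = (3/4, 1/4)` (index `(1, 0)`). The boundary polygon `a, (0,0), (1,0), b, (1/2,1/2)`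
bounds the open triangle `T` with vertices `0, 1, (1 + i)/2` (`Domain.triangle_carrier`: the
carrier IS `T = {0 < im z < re z, re z + im z < 1}`, by `polygonDomain_carrier_eq`), the test point
`a + (1/8)(1 - i) = (3/8, 1/8)` lies in `T` (so `T` is to the right of `[α_a, β_a] = [0, (1+i)/2]`),
`T` contains no Peano vertex, and the unique Peano path is the single Manhattan edge `a → b`
(the row `y = 1/4` is directed towards `+x`). Hence `Nonempty USTPeano.Domain`,
`Nonempty (PeanoPath Domain.triangle)`, and `ustLaw Domain.triangle` is a probability measure.
[LSW04] §4.1. Everything here is proved; nothing is cited beyond the definitions it instantiates.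
-/

noncomputable section

open Set Function Complex MeasureTheory

namespace Literature.Probability.RandomPlanarGeometry

namespace USTPeano

/-! ### The boundary polygon of the example -/

/-- The boundary vertex cycle of the example: `(1/4,1/4), (0,0), (1,0), (3/4,1/4), (1/2,1/2)`.
[folklore] -/
theorem boundaryVerts_triangle :
    boundaryVerts [(0, 0), (1, 0)] [(0, 0)] (0, 0) (1, 0) =
      [peanoPt (0, 0), primalPt (0, 0), primalPt (1, 0), peanoPt (1, 0), dualPt (0, 0)] := by
  simp [boundaryVerts]

/-- The five vertices in coordinates. [folklore] -/
theorem triangleVerts_eq :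
    [peanoPt (0, 0), primalPt (0, 0), primalPt (1, 0), peanoPt (1, 0), dualPt (0, 0)] =
      [(⟨1 / 4, 1 / 4⟩ : ℂ), ⟨0, 0⟩, ⟨1, 0⟩, ⟨3 / 4, 1 / 4⟩, ⟨1 / 2, 1 / 2⟩] := by
  norm_num [peanoPt, primalPt, dualPt, Complex.ext_iff]

/-- **The boundary polygon of the example is simple.** [folklore] -/
theorem isSimpleClosedPolygon_triangleVerts :
    IsSimpleClosedPolygon (boundaryVerts [(0, 0), (1, 0)] [(0, 0)] (0, 0) (1, 0)) := by
  rw [boundaryVerts_triangle, triangleVerts_eq]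
  refine IsSimpleClosedPolygon.of_lt (by simp) ?_ ?_
  · intro k hk
    have : k < 5 := by simpa using hk
    interval_cases k <;> simp [Complex.ext_iff]
  · intro i j hi hj hij
    have hj3 : j < 5 := by simpa using hj
    interval_cases j <;> interval_cases i <;>
    · simp only [List.length_cons, List.length_nil, Nat.reduceAdd, Nat.reduceMod,
        List.getElem_cons_zero, List.getElem_cons_succ, Set.disjoint_left]
      rintro _ ⟨θ, ⟨hθ0, hθ1⟩, rfl⟩ ⟨θ', ⟨hθ0', hθ1'⟩, h⟩
      have hre := congrArg Complex.re h
      have him := congrArg Complex.im h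
      simp [AffineMap.lineMap_apply_module'] at hre him
      nlinarith

/-- **The open triangle** `T` with vertices `0`, `1`, `(1 + i)/2`. [folklore] -/
def triangleSet : Set ℂ := {z | 0 < z.im ∧ z.im < z.re ∧ z.re + z.im < 1}

/-- `T` is open. [folklore] -/
theorem isOpen_triangleSet : IsOpen triangleSet :=
  (isOpen_lt continuous_const Complex.continuous_im).inter
    ((isOpen_lt Complex.continuous_im Complex.continuous_re).inter
      (isOpen_lt (Complex.continuous_re.add Complex.continuous_im) continuous_const))

/-- `T` is bounded. [folklore] -/
theorem isBounded_triangleSet : Bornology.IsBounded triangleSet := by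
  refine (Metric.isBounded_closedBall (x := (0 : ℂ)) (r := 2)).subset fun z ⟨h1, h2, h3⟩ ↦ ?_
  rw [Metric.mem_closedBall, dist_zero_right]
  refine (Complex.norm_le_abs_re_add_abs_im z).trans ?_
  rw [abs_of_pos (h1.trans h2), abs_of_pos h1]
  linarith

/-- `T` is nonempty: it contains the orientation test point `(3/8, 1/8)`. [folklore] -/
theorem mem_triangleSet : (⟨3 / 8, 1 / 8⟩ : ℂ) ∈ triangleSet := by
  refine ⟨?_, ?_, ?_⟩ <;> norm_num

/-- The closure of `T` lies in the closed triangle. [folklore] -/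
theorem closure_triangleSet_subset :
    closure triangleSet ⊆ {z | 0 ≤ z.im ∧ z.im ≤ z.re ∧ z.re + z.im ≤ 1} := by
  refine closure_minimal (fun z ⟨h1, h2, h3⟩ ↦ ⟨h1.le, h2.le, h3.le⟩) ?_
  exact (isClosed_le continuous_const Complex.continuous_im).inter
    ((isClosed_le Complex.continuous_im Complex.continuous_re).inter
      (isClosed_le (Complex.continuous_re.add Complex.continuous_im) continuous_const))

/-- **The frontier of `T` lies on the boundary polygon.** A frontier point satisfies the closed
inequalities and one of them with equality; each of the three sides is covered by one or two
edges of the polygon. [folklore] -/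
theorem frontier_triangleSet_subset :
    frontier triangleSet ⊆ range (polygonLoop (boundaryVerts [(0, 0), (1, 0)] [(0, 0)] (0, 0) (1, 0))) := by
  intro z hz
  rw [boundaryVerts_triangle, triangleVerts_eq, range_polygonLoop (by simp), mem_iUnion]
  have hcl := closure_triangleSet_subset (frontier_subset_closure hz)
  have hnot : z ∉ triangleSet := fun h ↦ by
    rw [frontier, isOpen_triangleSet.interior_eq] at hz
    exact hz.2 h
  obtain ⟨h1, h2, h3⟩ := hcl
  simp only [triangleSet, mem_setOf_eq, not_and, not_lt] at hnot
  simp only [List.length_cons, List.length_nil, segment_eq_image_lineMap, mem_image, mem_Icc]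
  -- which side?
  by_cases hi : z.im = 0
  · -- bottom side `[0, 1]`: edge 1
    refine ⟨⟨1, by norm_num⟩, z.re, ⟨by linarith, by linarith⟩, ?_⟩
    apply Complex.ext <;> simp [AffineMap.lineMap_apply_module', hi]
  have hi' : 0 < z.im := lt_of_le_of_ne h1 (Ne.symm hi)
  by_cases hd : z.im = z.re
  · -- left side `im = re`, `re ∈ (0, 1/2]`: edges 0 (`re ≤ 1/4`) and 4 (`re ≥ 1/4`)
    by_cases hq : z.re ≤ 1 / 4
    · refine ⟨⟨0, by norm_num⟩, 1 - 4 * z.re, ⟨by linarith, by linarith⟩, ?_⟩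
      apply Complex.ext <;> simp [AffineMap.lineMap_apply_module'] <;> linarith
    · refine ⟨⟨4, by norm_num⟩, 2 - 4 * z.re, ⟨by linarith, by linarith⟩, ?_⟩
      apply Complex.ext <;> simp [AffineMap.lineMap_apply_module'] <;> linarith
  have hd' : z.im < z.re := lt_of_le_of_ne h2 hd
  have hs : z.re + z.im = 1 := le_antisymm h3 (hnot hi' hd')
  -- right side `re + im = 1`, `im ∈ (0, 1/2)`: edges 2 (`im ≤ 1/4`) and 3 (`im ≥ 1/4`)
  by_cases hq : z.im ≤ 1 / 4
  · refine ⟨⟨2, by norm_num⟩, 4 * z.im, ⟨by linarith, by linarith⟩, ?_⟩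
    apply Complex.ext <;> simp [AffineMap.lineMap_apply_module'] <;> linarith
  · refine ⟨⟨3, by norm_num⟩, 4 * z.im - 1, ⟨by linarith, by linarith⟩, ?_⟩
    apply Complex.ext <;> simp [AffineMap.lineMap_apply_module'] <;> linarith

/-- **`T` misses the boundary polygon.** [folklore] -/
theorem disjoint_triangleSet :
    Disjoint triangleSet
      (range (polygonLoop (boundaryVerts [(0, 0), (1, 0)] [(0, 0)] (0, 0) (1, 0)))) := by
  rw [boundaryVerts_triangle, triangleVerts_eq, range_polygonLoop (by simp), Set.disjoint_left]
  rintro z ⟨h1, h2, h3⟩ hz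
  rw [mem_iUnion] at hz
  obtain ⟨⟨k, hk⟩, hz⟩ := hz
  have hk5 : k < 5 := by simpa using hk
  interval_cases k <;>
  · simp only [List.length_cons, List.length_nil, Nat.reduceAdd, Nat.reduceMod,
      List.getElem_cons_zero, List.getElem_cons_succ, segment_eq_image_lineMap] at hz
    obtain ⟨θ, ⟨hθ0, hθ1⟩, rfl⟩ := hz
    simp [AffineMap.lineMap_apply_module'] at h1 h2 h3 <;> linarith

/-- **The inside of the example polygon is the open triangle `T`.** [folklore] -/
theorem polygonDomain_triangle_carrier :
    (polygonDomain _ isSimpleClosedPolygon_triangleVerts).carrier = triangleSet :=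
  polygonDomain_carrier_eq _ _ isOpen_triangleSet isBounded_triangleSet ⟨_, mem_triangleSet⟩
    frontier_triangleSet_subset disjoint_triangleSet

/-- The orientation test point of the example is `(3/8, 1/8)`. [folklore] -/
theorem rightTestPt_zero : rightTestPt (0, 0) = ⟨3 / 8, 1 / 8⟩ := by
  simp only [rightTestPt, peanoPt, dualPt, primalPt, dualNbr, primalNbr]
  apply Complex.ext <;> simp <;> norm_num

/-! ### The example domain and its Peano path -/

/-- **The smallest domain of `𝔇*`**: `α = [(0,0), (1,0)]` (one primal edge), `β = [(1/2, 1/2)]`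
(one dual vertex), `a = (1/4, 1/4)`, `b = (3/4, 1/4)`; `D` is the open triangle `0, 1, (1+i)/2`.
Non-vacuity witness for `USTPeano.Domain`. [cite: LawlerSchrammWerner2004, §4.1] -/
def Domain.triangle : Domain where
  α := [(0, 0), (1, 0)]
  β := [(0, 0)]
  a := (0, 0)
  b := (1, 0)
  α_ne_nil := by simp
  β_ne_nil := by simp
  isChain_α := by decide
  isChain_β := by decide
  head_α := by decide
  head_β := by decide
  getLast_α := by decide
  getLast_β := by decide
  simple := isSimpleClosedPolygon_triangleVerts
  rightTestPt_mem := by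
    rw [polygonDomain_triangle_carrier, rightTestPt_zero]
    exact mem_triangleSet

/-- `𝔇*` is inhabited. [folklore] -/
instance : Nonempty Domain := ⟨Domain.triangle⟩

/-- The carrier of the example is the open triangle. [folklore] -/
theorem Domain.triangle_carrier : Domain.triangle.carrier = triangleSet :=
  polygonDomain_triangle_carrier

/-- **The example has no Peano vertex inside**: `(1/4 + i/2, 1/4 + j/2) ∈ T` forces `j ≥ 0`,
`j < i` and `i + j < 1`, impossible in integers. [folklore] -/
theorem Domain.triangle_peanoVerts : Domain.triangle.peanoVerts = ∅ := by
  ext ⟨i, j⟩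
  simp only [Domain.mem_peanoVerts, Domain.triangle_carrier, triangleSet, mem_setOf_eq,
    peanoPt_re, peanoPt_im, mem_empty_iff_false, iff_false, not_and, not_lt]
  intro h1 h2
  have hj : (-1 : ℝ) < j := by linarith
  have hij : (j : ℝ) < i := by linarith
  have hj' : -1 < j := by exact_mod_cast hj
  have hij' : j < i := by exact_mod_cast hij
  have : (1 : ℝ) ≤ i + j := by exact_mod_cast (show 1 ≤ i + j by omega)
  linarith

/-- **The Peano path of the example**: the single Manhattan edge `a = (1/4,1/4) → b = (3/4,1/4)`
(the row `j = 0` is directed towards `+x`); it avoids `α` (the real segment `[0, 1]`) and `β`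
(the point `(1/2, 1/2)`). [cite: LawlerSchrammWerner2004, §4.1] -/
def PeanoPath.triangle : PeanoPath Domain.triangle where
  verts := [(0, 0), (1, 0)]
  ne_nil := by simp
  head_eq := rfl
  getLast_eq := rfl
  isChain := by decide
  nodup := by decide
  mem_iff p := by
    simp only [Domain.triangle_peanoVerts, mem_empty_iff_false, or_false, List.mem_cons,
      List.not_mem_nil]
    rfl
  disjoint_edge e he := by
    simp only [List.tail_cons, List.zip_cons_cons, List.zip_nil_right, List.mem_singleton] at he
    subst he
    rw [Set.disjoint_left]
    rintro z hz hz'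
    rw [segment_eq_image_lineMap] at hz
    obtain ⟨θ, -, rfl⟩ := hz
    have him : (AffineMap.lineMap (peanoPt ((0 : ℤ), (0 : ℤ))) (peanoPt ((1 : ℤ), (0 : ℤ))) θ).im
        = 1 / 4 := by
      simp [AffineMap.lineMap_apply_module']
    -- `α ∪ β` consists of the real segment `[0, 1]` (with its endpoints) and the point `(1/2, 1/2)`
    rcases hz' with hα | hβ
    · rcases hα with ⟨v, hv, hzv⟩ | hα
      · have := congrArg Complex.im hzv
        rw [him, primalPt_im] at this
        simp only [Domain.triangle, List.mem_cons, List.not_mem_nil, or_false] at hv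
        rcases hv with rfl | rfl <;> norm_num at this
      · simp only [Domain.triangle, List.tail_cons, List.zip_cons_cons, List.zip_nil_right,
          mem_iUnion, List.mem_singleton, exists_prop] at hα
        obtain ⟨e, rfl, he⟩ := hα
        rw [segment_eq_image_lineMap] at he
        obtain ⟨θ', -, he⟩ := he
        have := congrArg Complex.im he
        rw [him] at this
        simp [AffineMap.lineMap_apply_module'] at this
    · rcases hβ with ⟨v, hv, hzv⟩ | hβ
      · have := congrArg Complex.im hzv
        rw [him, dualPt_im] at this
        simp only [Domain.triangle, List.mem_cons, List.not_mem_nil, or_false] at hv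
        subst hv
        norm_num at this
      · simp [Domain.triangle] at hβ

/-- The example has a Peano path (so `ustLaw Domain.triangle` is a probability measure, by the
instance `isProbabilityMeasure_ustLaw`). [folklore] -/
instance : Nonempty (PeanoPath Domain.triangle) := ⟨PeanoPath.triangle⟩

/-- The UST law of the example is a probability measure (instance found automatically). [folklore] -/
example : IsProbabilityMeasure (ustLaw Domain.triangle) := inferInstance

end USTPeano

end Literature.Probability.RandomPlanarGeometry
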